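import Literature.NumberTheory.LFunctions.SuzukiWeilModelSpace
import HarnessLib

/-!
# The Cauchy kernel and the model-space kernel on `𝖥(V(0)) = 𝒦(Θ_ξ)` — RH-FREE plumbing for CJM §5

LINE 1 — LABEL: RH-FREE corpus theorems (reproducing-kernel bookkeeping for M. Suzuki, *On the
Hilbert space derived from the Weil distribution*, Canad. J. Math. 2025 = arXiv:2301.00421v3, §2.3
"`H² = 𝖥L²(0,∞)` … identified with a closed subspace of `L²(ℝ)` via boundary values", §2.4 "the
model space `𝒦(Θ) = H² ⊖ ΘH²`", and the evaluation `ψ̂(z)`, eq. (1.1)). bears_on: B-C/B-P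
(LADDER-RH COLUMN 6 DBR) as infrastructure for the discharge of the RH-CONSEQUENCE facts
`Suzuki2025_thm55_normIdentity` / `Suzuki2025_orthogonalBasis` (CJM Thm. 5.5 (1), Prop. 4.1).
WHAT THIS IS NOT: no statement about RH, no inner-function or Hermite–Biehler property of `Θ_ξ`,
`E_ξ` is asserted or used; nothing here bears on the truth of RH.

## What is proved (all RH-FREE; `𝖥 = suzukiFourierL2`, `⟪𝖥a, 𝖥b⟫ = 2π⟪a, b⟫`)

* the **Cauchy vectors** `e_w := 1_{(0,∞)} e^{−i w̄ ·} ∈ L¹ ∩ L²` (`Im w > 0`):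
  `⟪e_w, ψ⟫ = ψ̂(w) := ∫₀^∞ ψ(x)e^{iwx}dx` for EVERY `ψ ∈ L²(ℝ)` (`inner_cauchyVec`), their
  transforms `ê_w(z) = i/(z − w̄)` on the closed upper half-plane (`upperHalfHat_cauchyVec`) and
  `𝖥e_w = i/(· − w̄)` a.e. (`suzukiFourierL2_cauchyVec`), `𝖥e_w ∈ H²`, and the **`H²` Cauchy
  formula by Plancherel** `ψ̂(w) = (2π)⁻¹⟪𝖥e_w, 𝖥ψ⟫` (`upperHalfHat_eq_inner_fourier`), with
  `⟪𝖥e_z, 𝖥e_w⟫ = 2πi/(z − w̄)` (`inner_fourier_cauchyVec`);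
* the **model-space kernel vectors** `K_w := (i/2π)(1 − conj Θ_ξ(w)·Θ_ξ)/(· − w̄) ∈ L²(ℝ)`
  (`modelKernelVec`; CJM §2.4: the reproducing kernel of `𝒦(Θ) = H² ⊖ ΘH²`) and the
  **reproducing formula on `𝖥(V(0))`**: for `ψ ∈ V(0)` and `Im w > 0`, `ψ̂(w) = ⟪K_w, 𝖥ψ⟫`
  (`inner_modelKernelVec`) — from the Cauchy formula and ONLY the orthogonality clause
  "`𝖥ψ ⊥ Θ·𝖥e_w`" of the boundary-value model space `modelSpaceL2` (the cell's RH-FREE bridge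
  `suzukiFourierL2_mem_modelSpaceL2_iff`); no inner-function property of `Θ_ξ` enters;
* **injectivity of the half-plane transform on `L²(0,∞)`**: `ψ̂ ≡ 0` on `ℂ₊` forces `ψ = 0`
  (`eq_zero_of_upperHalfHat_eq_zero`; via the boundary-value classes `𝖥[1_{(0,∞)}ψe^{−y·}]` of the
  cell's `suzukiFourierL2_indicator_mul_exp_ae_eq`).

## References
* M. Suzuki, Canad. J. Math. 2025 = arXiv:2301.00421v3, §2.3–2.4 p. 5 (TeX l.611–705), eq. (1.1),
  §5 (TeX l.1425–1447). [Suzuki2025WeilHilbertSpace]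
* J. Garnett, *Bounded analytic functions*, Ch. II §3 (Cauchy/Szegő kernel of `H²(ℂ₊)`). [folklore]
-/

noncomputable section

open MeasureTheory Complex Filter Set
open scoped ComplexConjugate FourierTransform Topology ENNReal InnerProductSpace

namespace Literature.NumberTheory.LFunctions

/-! ## A. The Cauchy vectors `e_w = 1_{(0,∞)} e^{−i w̄ x}` -/

/-- The **Cauchy vector** `e_w(x) := 1_{(0,∞)}(x)·e^{−i w̄ x}` (for `Im w > 0` an `L¹ ∩ L²`
function on `ℝ`): the half-line function whose transform is the Cauchy–Szegő kernel
`i/(z − w̄)` of `H²(ℂ₊)` and against which `⟪e_w, ψ⟫ = ψ̂(w)`. RH-FREE object.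
[cite: Suzuki2025WeilHilbertSpace, CJM §2.3 p. 5 (TeX l.615–619: "H² := H²(ℂ₊) = 𝖥(L²(0,∞)) … via boundary values")] -/
def cauchyFun (w : ℂ) (x : ℝ) : ℂ :=
  (Ioi (0 : ℝ)).indicator (fun x : ℝ ↦ cexp (-(I * conj w * x))) x

/-- `|e^{−i w̄ x}| = e^{−(Im w)x}`. [cite: Suzuki2025WeilHilbertSpace, CJM §2.3 p. 5 (TeX l.615–619: "H² = 𝖥(L²(0,∞))")] -/
theorem norm_cexp_neg_I_conj_mul (w : ℂ) (x : ℝ) :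
    ‖cexp (-(I * conj w * x))‖ = Real.exp (-(w.im * x)) := by
  rw [Complex.norm_exp]
  congr 1
  simp [Complex.mul_re, Complex.mul_im, Complex.I_re, Complex.I_im, Complex.conj_re,
    Complex.conj_im]

/-- `|e_w(x)| ≤ e^{−(Im w) x}` on `x > 0` and `= 0` on `x ≤ 0`; in closed form
`|e_w(x)| = 1_{(0,∞)}(x) e^{−(Im w)x}`. [cite: Suzuki2025WeilHilbertSpace, CJM §2.3 p. 5 (TeX l.615–619: "H² = 𝖥(L²(0,∞))")] -/
theorem norm_cauchyFun (w : ℂ) (x : ℝ) :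
    ‖cauchyFun w x‖ = (Ioi (0 : ℝ)).indicator (fun x : ℝ ↦ Real.exp (-(w.im * x))) x := by
  unfold cauchyFun
  by_cases hx : x ∈ Ioi (0 : ℝ)
  · rw [indicator_of_mem hx, indicator_of_mem hx, norm_cexp_neg_I_conj_mul]
  · rw [indicator_of_notMem hx, indicator_of_notMem hx, norm_zero]

/-- `e_w` is a.e.-strongly measurable. [cite: Suzuki2025WeilHilbertSpace, CJM §2.3 p. 5 (TeX l.615–619: "H² = 𝖥(L²(0,∞))")] -/
theorem aestronglyMeasurable_cauchyFun (w : ℂ) : AEStronglyMeasurable (cauchyFun w) volume := by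
  unfold cauchyFun
  exact ((by fun_prop : Continuous fun x : ℝ ↦ cexp (-(I * conj w * x))).aestronglyMeasurable).indicator
    measurableSet_Ioi

/-- `e_w` vanishes on `(−∞, 0]`. [cite: Suzuki2025WeilHilbertSpace, CJM §2.3 p. 5 (TeX l.615–619: "H² = 𝖥(L²(0,∞))")] -/
theorem cauchyFun_of_nonpos (w : ℂ) {x : ℝ} (hx : x ≤ 0) : cauchyFun w x = 0 := by
  unfold cauchyFun
  rw [indicator_of_notMem (by simpa using hx)]

/-- `e_w(x) = e^{−i w̄ x}` for `x > 0`. [cite: Suzuki2025WeilHilbertSpace, CJM §2.3 p. 5 (TeX l.615–619: "H² = 𝖥(L²(0,∞))")] -/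
theorem cauchyFun_of_pos (w : ℂ) {x : ℝ} (hx : 0 < x) : cauchyFun w x = cexp (-(I * conj w * x)) := by
  unfold cauchyFun
  rw [indicator_of_mem (by simpa using hx)]

/-- `e_w ∈ L¹(ℝ)` for `Im w > 0`. [cite: Suzuki2025WeilHilbertSpace, CJM §2.3 p. 5 (TeX l.615–619: "H² = 𝖥(L²(0,∞))")] -/
theorem integrable_cauchyFun {w : ℂ} (hw : 0 < w.im) : Integrable (cauchyFun w) := by
  have h : IntegrableOn (fun x : ℝ ↦ cexp (-(I * conj w * x))) (Ioi 0) := by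
    have e : (fun x : ℝ ↦ cexp (-(I * conj w * x))) = fun x : ℝ ↦ cexp (-(I * conj w) * x) := by
      funext x; ring_nf
    rw [e]
    refine integrableOn_exp_mul_complex_Ioi ?_ 0
    simp [Complex.mul_re, hw]
  unfold cauchyFun
  exact (integrable_indicator_iff measurableSet_Ioi).2 h

/-- `e_w ∈ L²(ℝ)` for `Im w > 0` (`|e_w|² = 1_{(0,∞)}e^{−2(Im w)x}`). [cite: Suzuki2025WeilHilbertSpace, CJM §2.3 p. 5 (TeX l.615–619: "H² = 𝖥(L²(0,∞))")] -/
theorem memLp_cauchyFun {w : ℂ} (hw : 0 < w.im) : MemLp (cauchyFun w) 2 volume := by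
  refine (memLp_two_iff_integrable_sq_norm (aestronglyMeasurable_cauchyFun w)).2 ?_
  have h : IntegrableOn (fun x : ℝ ↦ Real.exp (-(2 * w.im) * x)) (Ioi 0) :=
    exp_neg_integrableOn_Ioi 0 (by linarith)
  have e : (fun x : ℝ ↦ ‖cauchyFun w x‖ ^ 2) =
      (Ioi (0 : ℝ)).indicator fun x : ℝ ↦ Real.exp (-(2 * w.im) * x) := by
    funext x
    rw [norm_cauchyFun]
    by_cases hx : x ∈ Ioi (0 : ℝ)
    · rw [indicator_of_mem hx, indicator_of_mem hx, ← Real.exp_nat_mul]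
      congr 1; push_cast; ring
    · rw [indicator_of_notMem hx, indicator_of_notMem hx, zero_pow two_ne_zero]
  rw [e, integrable_indicator_iff measurableSet_Ioi]
  exact h

/-- The **Cauchy vector as an `L²(ℝ)`-class** (`Im w > 0`; the junk value `0` otherwise).
RH-FREE object. [cite: Suzuki2025WeilHilbertSpace, CJM §2.3 p. 5 (TeX l.615–619)] -/
def cauchyVec (w : ℂ) : Lp ℂ 2 (volume : Measure ℝ) :=
  if hw : 0 < w.im then (memLp_cauchyFun hw).toLp (cauchyFun w) else 0

/-- `cauchyVec w` is represented by `e_w`. [cite: Suzuki2025WeilHilbertSpace, CJM §2.3 p. 5 (TeX l.615–619: "H² = 𝖥(L²(0,∞))")] -/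
theorem coeFn_cauchyVec {w : ℂ} (hw : 0 < w.im) :
    (cauchyVec w : ℝ → ℂ) =ᵐ[volume] cauchyFun w := by
  unfold cauchyVec
  rw [dif_pos hw]
  exact MemLp.coeFn_toLp _

/-- `cauchyVec w = [e_w]` as a `toLp`. [cite: Suzuki2025WeilHilbertSpace, CJM §2.3 p. 5 (TeX l.615–619: "H² = 𝖥(L²(0,∞))")] -/
theorem cauchyVec_eq_toLp {w : ℂ} (hw : 0 < w.im) :
    cauchyVec w = (memLp_cauchyFun hw).toLp (cauchyFun w) := by
  unfold cauchyVec
  rw [dif_pos hw]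

/-- `e_w ∈ L²(0,∞)` (it vanishes on the negative half-line). [cite: Suzuki2025WeilHilbertSpace, CJM §2.3 p. 5 (TeX l.615: "H² = 𝖥(L²(0,∞))")] -/
theorem cauchyVec_mem_halfLineL2 {w : ℂ} (hw : 0 < w.im) : cauchyVec w ∈ halfLineL2 0 := by
  simp only [halfLineL2, mem_setOf_eq]
  filter_upwards [coeFn_cauchyVec hw] with x hx hx0
  rw [hx, cauchyFun_of_nonpos w hx0.le]

/-- **`⟪e_w, ψ⟫ = ψ̂(w)`** for every `ψ ∈ L²(ℝ)` and `Im w > 0`: the half-plane evaluation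
`ψ̂(w) = ∫₀^∞ ψ(x)e^{iwx}dx` (`upperHalfHat`) is the inner product with the Cauchy vector
(`conj e^{−i w̄ x} = e^{iwx}` for real `x`). RH-FREE.
[cite: Suzuki2025WeilHilbertSpace, CJM eq. (1.1) p. 2 ("ψ̂(z) := ∫ ψ(x)e^{izx}dx") and §2.3 p. 5] -/
theorem inner_cauchyVec {w : ℂ} (hw : 0 < w.im) (ψ : Lp ℂ 2 (volume : Measure ℝ)) :
    inner ℂ (cauchyVec w) ψ = upperHalfHat ψ w := by
  rw [inner_L2_eq_integral, upperHalfHat, ← integral_indicator measurableSet_Ioi]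
  refine integral_congr_ae ?_
  filter_upwards [coeFn_cauchyVec hw] with x hx
  rw [hx]
  by_cases hx0 : x ∈ Ioi (0 : ℝ)
  · rw [indicator_of_mem hx0, cauchyFun_of_pos w hx0, ← Complex.exp_conj, mul_comm]
    congr 2
    simp only [map_neg, map_mul, Complex.conj_I, Complex.conj_conj, Complex.conj_ofReal]
    ring
  · rw [indicator_of_notMem hx0, cauchyFun_of_nonpos w (not_lt.1 hx0), map_zero, zero_mul]

/-- **The transform of the Cauchy vector**: `ê_w(z) = ∫₀^∞ e^{−i w̄ x}e^{izx}dx = i/(z − w̄)` for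
`Im z ≥ 0` (absolutely convergent since `Im (z − w̄) = Im z + Im w > 0`). RH-FREE.
[cite: Suzuki2025WeilHilbertSpace, CJM §2.3 p. 5 (TeX l.615–619)] -/
theorem upperHalfHat_cauchyVec {w : ℂ} (hw : 0 < w.im) {z : ℂ} (hz : 0 ≤ z.im) :
    upperHalfHat (cauchyVec w) z = I / (z - conj w) := by
  have ha : (I * (z - conj w)).re < 0 := by
    simp [Complex.mul_re, Complex.sub_im, Complex.conj_im]
    linarith
  have hne : I * (z - conj w) ≠ 0 := fun h ↦ by rw [h, Complex.zero_re] at ha; exact lt_irrefl _ ha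
  unfold upperHalfHat
  calc ∫ x in Ioi (0 : ℝ), (cauchyVec w : ℝ → ℂ) x * cexp (I * z * x)
      = ∫ x in Ioi (0 : ℝ), cexp (I * (z - conj w) * x) := by
        refine setIntegral_congr_ae measurableSet_Ioi ?_
        filter_upwards [coeFn_cauchyVec hw] with x hx hx0
        rw [hx, cauchyFun_of_pos w hx0, ← Complex.exp_add]
        congr 1; ring
    _ = -cexp (I * (z - conj w) * (0 : ℝ)) / (I * (z - conj w)) := integral_exp_mul_complex_Ioi ha 0
    _ = I / (z - conj w) := by
        rw [Complex.ofReal_zero, mul_zero, Complex.exp_zero]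
        field_simp
        rw [Complex.I_sq]; ring

/-- Suzuki's whole-line transform of `e_w` at a real point: `ê_w(u) = i/(u − w̄)`.
[cite: Suzuki2025WeilHilbertSpace, CJM eq. (1.1) p. 2] -/
theorem suzukiHat_cauchyFun {w : ℂ} (hw : 0 < w.im) (u : ℝ) :
    suzukiHat (cauchyFun w) u = I / (u - conj w) := by
  have h1 : suzukiHat (cauchyFun w) u = upperHalfHat (cauchyFun w) u :=
    suzukiHat_eq_upperHalfHat (Eventually.of_forall fun x hx ↦ cauchyFun_of_nonpos w hx.le) u
  have h2 : upperHalfHat (cauchyFun w) u = upperHalfHat (cauchyVec w) u := by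
    unfold upperHalfHat
    refine setIntegral_congr_ae measurableSet_Ioi ?_
    filter_upwards [coeFn_cauchyVec hw] with x hx _
    rw [hx]
  rw [h1, h2, upperHalfHat_cauchyVec hw (by simp)]

/-- **`𝖥e_w = i/(· − w̄)` almost everywhere** (the Cauchy–Szegő kernel of `H²(ℂ₊)` on the line is
the transform of `e_w ∈ L¹ ∩ L²`, by the cell's dictionary `suzukiFourierL2_toLp_ae_eq_suzukiHat`).
RH-FREE. [cite: Suzuki2025WeilHilbertSpace, CJM §2.3 p. 5 (TeX l.615–619)] -/
theorem suzukiFourierL2_cauchyVec {w : ℂ} (hw : 0 < w.im) :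
    (suzukiFourierL2 (cauchyVec w) : ℝ → ℂ) =ᵐ[volume] fun u : ℝ ↦ I / (u - conj w) := by
  rw [cauchyVec_eq_toLp hw]
  filter_upwards [suzukiFourierL2_toLp_ae_eq_suzukiHat (integrable_cauchyFun hw)
    (memLp_cauchyFun hw)] with u hu
  rw [hu, suzukiHat_cauchyFun hw]

/-- `𝖥ψ ∈ H² ⟺ ψ ∈ L²(0,∞)` for Suzuki's `𝖥` (`H² = 𝖥L²(0,∞)`; the dilation `u ↦ u/2π` relating
`𝖥` to Mathlib's `𝓕⁻` preserves `H²`). RH-FREE. [cite: Suzuki2025WeilHilbertSpace, CJM §2.3 p. 5 (TeX l.615: "H² := H²(ℂ₊) = 𝖥(L²(0,∞))")] -/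
theorem suzukiFourierL2_mem_hardyL2_iff (ψ : Lp ℂ 2 (volume : Measure ℝ)) :
    suzukiFourierL2 ψ ∈ hardyL2 ↔ ψ ∈ halfLineL2 0 := by
  have hc : (0 : ℝ) < (2 * Real.pi)⁻¹ := inv_pos.2 Real.two_pi_pos
  have hSF : suzukiFourierL2 ψ =
      (Literature.Analysis.Fourier.memLp_comp_mul_left
        (Lp.memLp (𝓕⁻ ψ : Lp ℂ 2 (volume : Measure ℝ))) hc.ne').toLp _ := rfl
  rw [hSF, toLp_comp_mul_left_mem_hardyL2_iff _ hc, fourierInv_mem_hardyL2_iff]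

/-- `𝖥e_w ∈ H²`. [cite: Suzuki2025WeilHilbertSpace, CJM §2.3 p. 5 (TeX l.615–619)] -/
theorem suzukiFourierL2_cauchyVec_mem_hardyL2 {w : ℂ} (hw : 0 < w.im) :
    suzukiFourierL2 (cauchyVec w) ∈ hardyL2 :=
  (suzukiFourierL2_mem_hardyL2_iff _).2 (cauchyVec_mem_halfLineL2 hw)

/-- **The `H²` Cauchy formula by Plancherel**: `ψ̂(w) = (2π)⁻¹⟪𝖥e_w, 𝖥ψ⟫` for every `ψ ∈ L²(ℝ)`
and `Im w > 0` — i.e. `ψ̂(w) = (1/2πi)∫ (𝖥ψ)(x)/(x − w) dx` when `ψ ∈ L²(0,∞)` ("the inner product of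
`H²` coincides with the standard inner product of `L²(ℝ)`", and `⟪𝖥a, 𝖥b⟫ = 2π⟪a, b⟫`). RH-FREE.
[cite: Suzuki2025WeilHilbertSpace, CJM §2.3 p. 5 (TeX l.615–619) and §5 p. 13 (TeX l.1441)] -/
theorem upperHalfHat_eq_inner_fourier (ψ : Lp ℂ 2 (volume : Measure ℝ)) {w : ℂ} (hw : 0 < w.im) :
    upperHalfHat ψ w =
      ((2 * Real.pi)⁻¹ : ℂ) * inner ℂ (suzukiFourierL2 (cauchyVec w)) (suzukiFourierL2 ψ) := by
  rw [inner_suzukiFourierL2, inner_cauchyVec hw, ← mul_assoc]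
  have hπ : ((2 * Real.pi : ℝ) : ℂ) ≠ 0 := by exact_mod_cast Real.two_pi_pos.ne'
  push_cast at hπ ⊢
  rw [inv_mul_cancel₀ hπ, one_mul]

/-- **`⟪𝖥e_z, 𝖥e_w⟫ = 2πi/(z − w̄)`** (`= 2π ê_w(z)`). RH-FREE.
[cite: Suzuki2025WeilHilbertSpace, CJM §2.3 p. 5 (TeX l.615–619)] -/
theorem inner_fourier_cauchyVec {z w : ℂ} (hz : 0 < z.im) (hw : 0 < w.im) :
    inner ℂ (suzukiFourierL2 (cauchyVec z)) (suzukiFourierL2 (cauchyVec w)) =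
      2 * Real.pi * I / (z - conj w) := by
  rw [inner_suzukiFourierL2, inner_cauchyVec hz, upperHalfHat_cauchyVec hw hz.le]
  push_cast
  ring

/-! ## A'. `H²` is a closed subspace of `L²(ℝ)` -/

/-- `0 ∈ H²`. [cite: Suzuki2025WeilHilbertSpace, CJM §2.3 p. 5 (TeX l.617–618: "we identify H² with a closed subspace of L²(ℝ)")] -/
theorem zero_mem_hardyL2 : (0 : Lp ℂ 2 (volume : Measure ℝ)) ∈ hardyL2 := by
  rw [mem_hardyL2_iff, FourierTransform.fourier_zero]
  exact zero_mem_halfLineL2 0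

/-- `H²` is closed under addition. [cite: Suzuki2025WeilHilbertSpace, CJM §2.3 p. 5 (TeX l.617–618)] -/
theorem add_mem_hardyL2 {F G : Lp ℂ 2 (volume : Measure ℝ)} (hF : F ∈ hardyL2) (hG : G ∈ hardyL2) :
    F + G ∈ hardyL2 := by
  rw [mem_hardyL2_iff] at hF hG ⊢
  rw [FourierTransform.fourier_add]
  exact add_mem_halfLineL2 hF hG

/-- `H²` is closed under scalars. [cite: Suzuki2025WeilHilbertSpace, CJM §2.3 p. 5 (TeX l.617–618)] -/
theorem smul_mem_hardyL2 (c : ℂ) {F : Lp ℂ 2 (volume : Measure ℝ)} (hF : F ∈ hardyL2) :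
    c • F ∈ hardyL2 := by
  rw [mem_hardyL2_iff] at hF ⊢
  rw [FourierTransform.fourier_smul]
  exact smul_mem_halfLineL2 c hF

/-- **`H²` as a `ℂ`-submodule of `L²(ℝ)`.** RH-FREE object.
[cite: Suzuki2025WeilHilbertSpace, CJM §2.3 p. 5 (TeX l.617–618: "a closed subspace of L²(ℝ)")] -/
def hardyL2Submodule : Submodule ℂ (Lp ℂ 2 (volume : Measure ℝ)) where
  carrier := hardyL2
  zero_mem' := zero_mem_hardyL2
  add_mem' := add_mem_hardyL2
  smul_mem' := smul_mem_hardyL2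

/-- Membership in `hardyL2Submodule` is membership in `hardyL2`. [cite: Suzuki2025WeilHilbertSpace, CJM §2.3 p. 5 (TeX l.615–619: "H² = 𝖥(L²(0,∞))")] -/
@[simp] theorem mem_hardyL2Submodule {F : Lp ℂ 2 (volume : Measure ℝ)} :
    F ∈ hardyL2Submodule ↔ F ∈ hardyL2 := Iff.rfl

/-- `H²` is closed in `L²(ℝ)` (preimage of the closed `L²(0,∞)` under the unitary `𝓕`).
[folklore] -/
private theorem isClosed_hardyL2_aux : IsClosed (hardyL2 : Set (Lp ℂ 2 (volume : Measure ℝ))) :=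
  (isClosed_halfLineL2 0).preimage
    (FourierTransform.continuous_fourier (E := Lp ℂ 2 (volume : Measure ℝ))
      (F := Lp ℂ 2 (volume : Measure ℝ)))

/-- **`H²` is a closed subspace of `L²(ℝ)`**: its topological closure is itself.
[cite: Suzuki2025WeilHilbertSpace, CJM §2.3 p. 5 (TeX l.617–618: "we identify H² with a closed subspace of L²(ℝ)")] -/
theorem hardyL2Submodule_topologicalClosure :
    hardyL2Submodule.topologicalClosure = hardyL2Submodule :=
  isClosed_hardyL2_aux.submodule_topologicalClosure_eq

/-- `H²` is complete (a closed subspace of the Hilbert space `L²(ℝ)`). [cite: Suzuki2025WeilHilbertSpace, CJM §2.3 p. 5 (TeX l.617–618)] -/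
theorem completeSpace_hardyL2Submodule : CompleteSpace hardyL2Submodule :=
  isClosed_hardyL2_aux.completeSpace_coe

/-- **Limits of `H²` functions are in `H²`** (sequential closedness, the form used downstream).
[cite: Suzuki2025WeilHilbertSpace, CJM §2.3 p. 5 (TeX l.617–618: "a closed subspace of L²(ℝ)")] -/
theorem mem_hardyL2_of_tendsto {ι : Type*} {l : Filter ι} [l.NeBot] {u : ι → Lp ℂ 2 (volume : Measure ℝ)}
    {F : Lp ℂ 2 (volume : Measure ℝ)} (hu : ∀ i, u i ∈ hardyL2) (h : Tendsto u l (𝓝 F)) :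
    F ∈ hardyL2 :=
  isClosed_hardyL2_aux.mem_of_tendsto h (Eventually.of_forall hu)

/-! ## B. Multiplication by `Θ_ξ` on `L²(ℝ)` and the model-space kernel vectors `K_w` -/

/-- `Θ_ξ · G ∈ L²(ℝ)` for `G ∈ L²(ℝ)` (`|Θ_ξ| ≤ 1` on the line). RH-FREE.
[cite: Suzuki2025WeilHilbertSpace, CJM §5 p. 13 (TeX l.1436–1441: "𝖬_Θ … isometries on L²(ℝ)")] -/
theorem memLp_lagariasTheta_mul (G : Lp ℂ 2 (volume : Measure ℝ)) :
    MemLp (fun x : ℝ ↦ lagariasTheta x * (G : ℝ → ℂ) x) 2 volume := by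
  refine MemLp.of_le (Lp.memLp G) ?_ (Eventually.of_forall fun x ↦ ?_)
  · exact ((measurable_lagariasTheta.comp Complex.measurable_ofReal).aestronglyMeasurable).mul
      (Lp.aestronglyMeasurable G)
  · rw [norm_mul]
    exact mul_le_of_le_one_left (norm_nonneg _) (norm_lagariasTheta_ofReal_le_one x)

/-- The multiplication operator `𝖬_{Θ_ξ} : G ↦ Θ_ξ · G` on `L²(ℝ)` (symbol restricted to the
real line). RH-FREE object.
[cite: Suzuki2025WeilHilbertSpace, CJM §5 p. 13 (TeX l.1434–1436: "(𝖬_Θ F)(z) := Θ(z)F(z)")] -/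
def thetaMul (G : Lp ℂ 2 (volume : Measure ℝ)) : Lp ℂ 2 (volume : Measure ℝ) :=
  (memLp_lagariasTheta_mul G).toLp _

/-- `𝖬_Θ G = Θ_ξ · G` almost everywhere. [cite: Suzuki2025WeilHilbertSpace, CJM §5 p. 13 (TeX l.1434–1436)] -/
theorem coeFn_thetaMul (G : Lp ℂ 2 (volume : Measure ℝ)) :
    (thetaMul G : ℝ → ℂ) =ᵐ[volume] fun x : ℝ ↦ lagariasTheta x * (G : ℝ → ℂ) x :=
  MemLp.coeFn_toLp _

/-- `⟪𝖬_Θ G, F⟫ = ∫ conj(Θ_ξ(x)G(x)) F(x) dx` — the integral in the orthogonality clause of the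
cell's `modelSpaceL2`. [cite: Suzuki2025WeilHilbertSpace, CJM §2.4 p. 5 (TeX l.689–700: "𝒦(Θ) = H² ⊖ ΘH²")] -/
theorem inner_thetaMul (G F : Lp ℂ 2 (volume : Measure ℝ)) :
    inner ℂ (thetaMul G) F = ∫ x : ℝ, conj (lagariasTheta x * (G : ℝ → ℂ) x) * (F : ℝ → ℂ) x := by
  rw [inner_L2_eq_integral]
  refine integral_congr_ae ?_
  filter_upwards [coeFn_thetaMul G] with x hx
  rw [hx]

/-- Orthogonality clause of the model space: for `F ∈ 𝒦(Θ_ξ)` (boundary-value form) and `G ∈ H²`,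
`⟪Θ_ξ·G, F⟫ = 0`. RH-FREE (definition unfolding).
[cite: Suzuki2025WeilHilbertSpace, CJM §2.4 p. 5 (TeX l.689–700)] -/
theorem inner_thetaMul_eq_zero_of_mem_modelSpaceL2 {F G : Lp ℂ 2 (volume : Measure ℝ)}
    (hF : F ∈ modelSpaceL2 lagariasTheta) (hG : G ∈ hardyL2) : inner ℂ (thetaMul G) F = 0 := by
  rw [inner_thetaMul]
  exact hF.2 G hG

/-- The **model-space kernel vector** `K_w := (2π)⁻¹·(𝖥e_w − conj Θ_ξ(w)·Θ_ξ·𝖥e_w) ∈ L²(ℝ)`,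
i.e. `K_w(x) = (i/2π)(1 − conj Θ_ξ(w) Θ_ξ(x))/(x − w̄)` a.e. — the reproducing kernel of the model
space `𝒦(Θ) = H² ⊖ ΘH²` at `w ∈ ℂ₊` (CJM §2.4), as an honest `L²(ℝ)`-class (RH-FREE object; its
reproducing property on `𝖥(V(0))` below uses no inner-function hypothesis).
[cite: Suzuki2025WeilHilbertSpace, CJM §2.4 p. 5 (TeX l.689–705: "𝒦(Θ) = H² ⊖ ΘH² … the inner product of 𝒦(Θ) matches that of L²(ℝ)")] -/
def modelKernelVec (w : ℂ) : Lp ℂ 2 (volume : Measure ℝ) :=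
  ((2 * Real.pi)⁻¹ : ℂ) •
    (suzukiFourierL2 (cauchyVec w) - conj (lagariasTheta w) • thetaMul (suzukiFourierL2 (cauchyVec w)))

/-- `K_w(x) = (i/2π)(1 − conj Θ_ξ(w)Θ_ξ(x))/(x − w̄)` almost everywhere (`Im w > 0`).
[cite: Suzuki2025WeilHilbertSpace, CJM §2.4 p. 5 (TeX l.689–705)] -/
theorem coeFn_modelKernelVec {w : ℂ} (hw : 0 < w.im) :
    (modelKernelVec w : ℝ → ℂ) =ᵐ[volume] fun x : ℝ ↦
      ((2 * Real.pi)⁻¹ : ℂ) * (I * (1 - conj (lagariasTheta w) * lagariasTheta x) / (x - conj w)) := by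
  unfold modelKernelVec
  filter_upwards [Lp.coeFn_smul ((2 * Real.pi)⁻¹ : ℂ)
      (suzukiFourierL2 (cauchyVec w) - conj (lagariasTheta w) • thetaMul (suzukiFourierL2 (cauchyVec w))),
    Lp.coeFn_sub (suzukiFourierL2 (cauchyVec w))
      (conj (lagariasTheta w) • thetaMul (suzukiFourierL2 (cauchyVec w))),
    Lp.coeFn_smul (conj (lagariasTheta w)) (thetaMul (suzukiFourierL2 (cauchyVec w))),
    coeFn_thetaMul (suzukiFourierL2 (cauchyVec w)), suzukiFourierL2_cauchyVec hw]
    with x h1 h2 h3 h4 h5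
  rw [h1, Pi.smul_apply, h2, Pi.sub_apply, h3, Pi.smul_apply, h4, h5, smul_eq_mul, smul_eq_mul]
  ring

/-- **The reproducing formula on `𝖥(V(0))` (RH-FREE): `ψ̂(w) = ⟪K_w, 𝖥ψ⟫`** for `ψ ∈ V(0)` and
`Im w > 0`. Proof: `⟪K_w, 𝖥ψ⟫ = (2π)⁻¹(⟪𝖥e_w, 𝖥ψ⟫ − Θ(w)⟪Θ·𝖥e_w, 𝖥ψ⟫)`; the first term is
`ψ̂(w)` by the `H²` Cauchy formula, the second vanishes because `𝖥ψ ∈ 𝒦(Θ) = 𝖥(V(0))`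
(the cell's `suzukiFourierL2_mem_modelSpaceL2_iff`) is orthogonal to `Θ·𝖥e_w ∈ ΘH²`. Only the
boundary-value definition of `𝒦(Θ)` is used. [cite: Suzuki2025WeilHilbertSpace, CJM §2.4 p. 5 (TeX l.689–705) and Lemma 5.1 p. 13 (TeX l.1464–1471: "𝒦(Θ) = 𝖥(V(0))")] -/
theorem inner_modelKernelVec {ψ : Lp ℂ 2 (volume : Measure ℝ)} (hψ : ψ ∈ suzukiV 0) {w : ℂ}
    (hw : 0 < w.im) : inner ℂ (modelKernelVec w) (suzukiFourierL2 ψ) = upperHalfHat ψ w := by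
  have hF : suzukiFourierL2 ψ ∈ modelSpaceL2 lagariasTheta :=
    (suzukiFourierL2_mem_modelSpaceL2_iff ψ).2 hψ
  have h0 : inner ℂ (thetaMul (suzukiFourierL2 (cauchyVec w))) (suzukiFourierL2 ψ) = 0 :=
    inner_thetaMul_eq_zero_of_mem_modelSpaceL2 hF (suzukiFourierL2_cauchyVec_mem_hardyL2 hw)
  unfold modelKernelVec
  rw [inner_smul_left, inner_sub_left, inner_smul_left, h0, mul_zero, sub_zero,
    upperHalfHat_eq_inner_fourier ψ hw]
  congr 1
  rw [map_inv₀, map_mul, map_ofNat, Complex.conj_ofReal]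

/-! ## C. Injectivity of the half-plane transform on `L²(0,∞)` -/

/-- **`ψ ∈ L²(0,∞)` with `ψ̂ ≡ 0` on `ℂ₊` is zero.** For `y > 0` the class of `x ↦ ψ̂(x + iy)` is
`𝖥[1_{(0,∞)}ψe^{−y·}]` (the cell's `suzukiFourierL2_indicator_mul_exp_ae_eq`); if it vanishes then
`‖1_{(0,∞)}ψe^{−y·}‖ = 0` (`‖𝖥φ‖² = 2π‖φ‖²`), so `ψ = 0` a.e. on `(0,∞)`, and on `(−∞,0)` by
hypothesis. (Uniqueness for the Fourier–Laplace transform on `H² = 𝖥L²(0,∞)`.) RH-FREE.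
[cite: Suzuki2025WeilHilbertSpace, CJM §2.3 p. 5 (TeX l.615–619: "H² = 𝖥(L²(0,∞)) … identified with a closed subspace of L²(ℝ) via boundary values")] -/
theorem eq_zero_of_upperHalfHat_eq_zero {ψ : Lp ℂ 2 (volume : Measure ℝ)} (hψ : ψ ∈ halfLineL2 0)
    (h : ∀ w : ℂ, 0 < w.im → upperHalfHat ψ w = 0) : ψ = 0 := by
  -- the damped function at height `y = 1`
  set φ : Lp ℂ 2 (volume : Measure ℝ) := (memLp_two_indicator_mul_exp ψ zero_le_one).toLp _ with hφ
  have hFφ : suzukiFourierL2 φ = 0 := by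
    refine Lp.ext ?_
    filter_upwards [suzukiFourierL2_indicator_mul_exp_ae_eq ψ one_pos,
      Lp.coeFn_zero ℂ 2 (volume : Measure ℝ)] with x hx h0
    rw [hφ, hx, h0, Pi.zero_apply]
    exact h _ (by simp)
  have hφ0 : φ = 0 := by
    have h1 := norm_sq_suzukiFourierL2 φ
    rw [hFφ, norm_zero, zero_pow two_ne_zero] at h1
    have h2 : ‖φ‖ ^ 2 = 0 := by
      have := Real.two_pi_pos
      nlinarith [sq_nonneg ‖φ‖]
    exact norm_eq_zero.1 (pow_eq_zero_iff two_ne_zero |>.1 h2)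
  -- read off `ψ = 0` a.e.
  refine Lp.ext ?_
  have hae : (φ : ℝ → ℂ) =ᵐ[volume] fun t : ℝ ↦
      (Ioi (0 : ℝ)).indicator (ψ : ℝ → ℂ) t * (Real.exp (-(1 * t)) : ℂ) := by
    rw [hφ]; exact MemLp.coeFn_toLp _
  have hψ' : ∀ᵐ x : ℝ, x < 0 → (ψ : ℝ → ℂ) x = 0 := hψ
  have hx0 : ∀ᵐ x : ℝ, x ≠ 0 := by
    have : ({0}ᶜ : Set ℝ) ∈ ae (volume : Measure ℝ) := by
      rw [compl_mem_ae_iff, measure_singleton]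
    exact this
  rw [hφ0] at hae
  filter_upwards [hae, hψ', hx0, Lp.coeFn_zero ℂ 2 (volume : Measure ℝ)] with x h1 h2 h3 h4
  rw [h4, Pi.zero_apply]
  rcases lt_or_gt_of_ne h3 with hx | hx
  · exact h2 hx
  · rw [h4, Pi.zero_apply, indicator_of_mem (mem_Ioi.2 hx)] at h1
    have hexp : (Real.exp (-(1 * x)) : ℂ) ≠ 0 := by exact_mod_cast (Real.exp_pos _).ne'
    exact (mul_eq_zero.1 h1.symm).resolve_right hexp

/-- Hence two elements of `L²(0,∞)` with the same half-plane transform on `ℂ₊` are equal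
(`upperHalfHat` is additive). RH-FREE. [cite: Suzuki2025WeilHilbertSpace, CJM §2.3 p. 5 (TeX l.615–619)] -/
theorem eq_of_upperHalfHat_eq {ψ₁ ψ₂ : Lp ℂ 2 (volume : Measure ℝ)} (h₁ : ψ₁ ∈ halfLineL2 0)
    (h₂ : ψ₂ ∈ halfLineL2 0) (h : ∀ w : ℂ, 0 < w.im → upperHalfHat ψ₁ w = upperHalfHat ψ₂ w) :
    ψ₁ = ψ₂ := by
  have h0 := eq_zero_of_upperHalfHat_eq_zero (sub_mem_halfLineL2 h₁ h₂) fun w hw ↦ by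
    rw [upperHalfHat_sub ψ₁ ψ₂ hw, h w hw, sub_self]
  exact sub_eq_zero.1 h0

/-- **An element of `H²` is determined by its Cauchy pairings**: if `F ∈ H²` and `⟪𝖥e_w, F⟫ = 0`
for every `w ∈ ℂ₊`, then `F = 0` (write `F = 𝖥ψ`, `ψ ∈ L²(0,∞)`; the pairings are `2πψ̂(w)`).
RH-FREE. [cite: Suzuki2025WeilHilbertSpace, CJM §2.3 p. 5 (TeX l.615–619)] -/
theorem eq_zero_of_inner_fourier_cauchyVec_eq_zero {F : Lp ℂ 2 (volume : Measure ℝ)}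
    (hF : F ∈ hardyL2)
    (h : ∀ w : ℂ, 0 < w.im → inner ℂ (suzukiFourierL2 (cauchyVec w)) F = 0) : F = 0 := by
  obtain ⟨ψ, rfl⟩ := suzukiFourierL2_surjective F
  have hψ : ψ ∈ halfLineL2 0 := (suzukiFourierL2_mem_hardyL2_iff ψ).1 hF
  have hψ0 : ψ = 0 := eq_zero_of_upperHalfHat_eq_zero hψ fun w hw ↦ by
    rw [upperHalfHat_eq_inner_fourier ψ hw, h w hw, mul_zero]
  rw [hψ0]
  have h := suzukiFourierL2_smul 0 (0 : Lp ℂ 2 (volume : Measure ℝ))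
  rwa [zero_smul, zero_smul] at h

end Literature.NumberTheory.LFunctions

end
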